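import Summits.QuantumFields.BalabanUV.T4Continuum.Support.GradedWellUnitDict
import Summits.QuantumFields.BalabanUV.T4Continuum.Support.GradedWellSlice
import Summits.QuantumFields.BalabanUV.T4Continuum.Support.GradedContourRefine
import Summits.QuantumFields.BalabanUV.T4Continuum.Support.ScalarBlockPoincareLocal

/-!
# T⁴ programme, spine node NE2 (U1a), sub-row Δ1 — graded well, crew socket (GW-W1), file 3a of 4:
# THE BLOCK CHART OF THE SUB-BLOCK GRID (the scale-`s_i` anchors inside ONE unit block, parametrised by `[0, n/s_i)^d`) and the
# DISCRETE POINCARÉ INEQUALITY ON THAT GRID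

NE2 formalisation swarm `b2b-balaban-t4-ne2-formalise-*`, leaf 09 (gen 11), for the owner's socket (GW-W1) (R47 (e)/R48 (c)/R49 (a),
journal 2026-08-21).  On the owner's anchor API (`GradedSubBlocks`: `Anc`, `site`, `meanS`, `shiftAnc`; `GradedSubBlocksRefine`: `anchorOf`,
`sum_inSub_refine`), leaf-07-g11's `GradedContourRefine.mulOff`/`anchor_site_mulOff` (the offsets `t·o`, `o ∈ [0, n/t)^d`) and leaf-01-g4's
cube Poincaré `ScalarBlockPoincareLocal.sum_norm_sub_mean_sq_le_cube` BY NAME.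

WHY (step (E) of the (GW-W1) transfer, file 3b).  A unit gauge function `μ` has zero UNIT-block means; the residual gauge group of the
graded well asks for zero SUB-block means on the layers.  The correction plants the sub-block means of `μ` back (file 2's `plantGW`);
its energy is controlled by the SQUARES of those means, and the squares of zero-sum grid values are controlled by the squares of their
nearest-neighbour DIFFERENCES inside the block — a discrete Poincaré inequality on the `(n/t)^d` grid of scale-`t` anchors of one unit
block, with constant `≍ (n/t)²`; the differences are exactly the layer's rows of `Q_GW(∂μ)` (file 3b).

 * §1 `stepR` (one grid step in direction `μ`), **`cube_poincare_zero_sum`**: for `F : (Fin d → Fin R) → ℂ` with `Σ F = 0`,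
   `Σ ‖F‖² ≤ (R²/2)·Σ_μ Σ_{o : o_μ + 1 < R} ‖F(o + e_μ) − F(o)‖²` (leaf-01-g4's cube lemma, mean-zero form, any `R ≥ 1`).
 * §2 THE CHART **`chartA Z o`** (`= Z + t·o`, a scale-`t` anchor, for a scale-`n` anchor `Z` = a unit block and `o ∈ [0, n/t)^d`):
   `blockOf_chartA` (it stays in the block), **`chartA_stepR`** (one grid step = the anchor shift `+ t·e_μ` while `o_μ + 1 < n/t`),
   **`chartA_bijective`** (`(Z, o) ↦ Z + t·o` is a bijection onto ALL scale-`t` anchors), `sum_anchors_eq_sum_chart` (re-indexing),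
   `inSub_chartA_iff` (the sub-block of `Z + t·o` lies in the unit block of `Z′` iff `Z′ = Z`);
 * §3 **`sum_chart_meanS_eq_zero`**: if the scale-`n` (unit) mean of `f` over the block `Z` vanishes, the scale-`t` means of `f` over the
   `(n/t)^d` sub-blocks of `Z` sum to zero (the owner's means of means `sum_inSub_refine`).

HONEST FRAMING (T4-DAG p. 1).  [folklore] finite-torus combinatorics + one discrete Poincaré inequality (leaf-01-g4's, re-read); constants
ours; no estimate of print; NE2 (U1a) NOT proved; spine PROVED 0/9 unchanged; NOT [B9] (3.16)/(3.23)–(3.27) as printed; NOT infinite volume /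
mass gap / Clay.  HONEST DEPENDENCY: continuum YM on T⁴ ⇐ BetaPertH ∧ nine spine estimates (0/9 proved); BetaPertH ⇐ (D1) ∧ (D4) ∧
CAP+tail; G-an2-4 gates asym, D1 and NE2/3/4.  ABSOLUTE RULE kept: no `def … : Prop` fact, no cited hypothesis, zero `sorry`.
-/

noncomputable section

open scoped BigOperators ComplexConjugate Matrix
open Finset

namespace Summit.QuantumFields.BalabanUV.T4Continuum.GradedWellBlockChart

open Literature.MathematicalPhysics.QuantumFieldTheory.Balaban1983to89.B5Prop11Plancherel (Tor fine)
open Literature.MathematicalPhysics.QuantumFieldTheory.Balaban1983to89.B5Prop11Lower (nsq)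
open Literature.MathematicalPhysics.QuantumFieldTheory.Balaban1983to89.B5Block118 (tstep)
open Literature.MathematicalPhysics.QuantumFieldTheory.Balaban1983to89.B5Blocks16 (blockOf)
open Literature.MathematicalPhysics.QuantumFieldTheory.Balaban1983to89.B5G183RateUnitTower (lev lev_neZero)
open Literature.MathematicalPhysics.QuantumFieldTheory.Balaban1983to89.Beta.CoordCubePoincare (stepUp)
open Summit.QuantumFields.BalabanUV.T4Continuum
open Summit.QuantumFields.BalabanUV.T4Continuum.ScalarBlockPoincareLocal (sum_norm_sub_mean_sq_le_cube)
open Summit.QuantumFields.BalabanUV.T4Continuum.GradedSubBlocks (Anchor Anc InSub site meanS shiftAnc s_pos val_site inSub_site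
  site_injective eq_site_of_inSub anchor_eq_of_inSub)
open Summit.QuantumFields.BalabanUV.T4Continuum.GradedSubBlocksRefine (anchorOf inSub_anchorOf eq_anchorOf_of_inSub sum_inSub_refine
  blockOf_eq_of_inSub)
open Summit.QuantumFields.BalabanUV.T4Continuum.GradedContourRefine (mulOff mulOff_val anchor_site_mulOff)
open Summit.QuantumFields.BalabanUV.T4Continuum.GradedWellData
open Summit.QuantumFields.BalabanUV.T4Continuum.GradedWellSlice (sGW_dvd_lev)
open Summit.QuantumFields.BalabanUV.T4Continuum.GradedWellUnitDict (dvd_fine blockOf_anchor_bijective)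

variable {d : ℕ}

/-! ## §1 The discrete Poincaré inequality on the grid `[0, R)^d`, zero-sum form -/

section Cube

/-- one grid step in direction `μ` (coordinate `μ` incremented modulo `R`; used only while `o_μ + 1 < R`). [folklore] -/
def stepR {R : ℕ} (o : Fin d → Fin R) (μ : Fin d) : Fin d → Fin R :=
  Function.update o μ ⟨((o μ : ℕ) + 1) % R, Nat.mod_lt _ (lt_of_le_of_lt (Nat.zero_le _) (o μ).isLt)⟩

/-- the stepped coordinate. [folklore] -/
theorem stepR_apply_self {R : ℕ} (o : Fin d → Fin R) (μ : Fin d) (h : (o μ : ℕ) + 1 < R) : (stepR o μ μ : ℕ) = (o μ : ℕ) + 1 := by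
  simp only [stepR, Function.update_self, Nat.mod_eq_of_lt h]

/-- the other coordinates are unchanged. [folklore] -/
theorem stepR_apply_ne {R : ℕ} (o : Fin d → Fin R) {μ ν : Fin d} (h : ν ≠ μ) : stepR o μ ν = o ν := by
  simp only [stepR, Function.update_of_ne h]

/-- B5/β's `stepUp` is `stepR` away from the last coordinate value. [folklore] -/
theorem stepUp_eq_stepR {R : ℕ} (o : Fin d → Fin (R + 1)) (μ : Fin d) (h : (o μ : ℕ) + 1 < R + 1) : stepUp o μ = stepR o μ := by
  funext ν
  by_cases hν : ν = μ
  · subst hν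
    apply Fin.ext
    rw [stepR_apply_self o ν h]
    simp only [stepUp, Function.update_self]
    exact Fin.val_add_one_of_lt' h
  · rw [stepR_apply_ne o hν]
    simp only [stepUp, Function.update_of_ne hν]

/-- **THE DISCRETE POINCARÉ INEQUALITY ON `[0, R)^d`, ZERO-SUM FORM**: `Σ F = 0 ⟹ Σ_o ‖F o‖² ≤ (R²/2)·Σ_μ Σ_{o : o_μ+1<R} ‖F(o + e_μ) − F(o)‖²`
(leaf-01-g4's `sum_norm_sub_mean_sq_le_cube`, constant `R(R−1)/2 ≤ R²/2`, any `R ≥ 1`). [folklore] -/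
theorem cube_poincare_zero_sum {R : ℕ} (hR : 0 < R) (F : (Fin d → Fin R) → ℂ) (h0 : ∑ o, F o = 0) :
    ∑ o, ‖F o‖ ^ 2
      ≤ (R : ℝ) ^ 2 / 2 * ∑ μ : Fin d, ∑ o ∈ univ.filter (fun o : Fin d → Fin R => (o μ : ℕ) + 1 < R), ‖F (stepR o μ) - F o‖ ^ 2 := by
  obtain ⟨R', rfl⟩ : ∃ R', R = R' + 1 := ⟨R - 1, by omega⟩
  have h := sum_norm_sub_mean_sq_le_cube R' d F
  rw [h0, zero_div] at h
  simp only [sub_zero] at h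
  have e : ∀ μ : Fin d, ∑ y ∈ univ.filter (fun y : Fin d → Fin (R' + 1) => y μ ≠ Fin.last R'), ‖F (stepUp y μ) - F y‖ ^ 2
      = ∑ o ∈ univ.filter (fun o : Fin d → Fin (R' + 1) => (o μ : ℕ) + 1 < R' + 1), ‖F (stepR o μ) - F o‖ ^ 2 := by
    intro μ
    have hf : univ.filter (fun y : Fin d → Fin (R' + 1) => y μ ≠ Fin.last R')
        = univ.filter (fun o : Fin d → Fin (R' + 1) => (o μ : ℕ) + 1 < R' + 1) := by
      ext y
      simp only [Finset.mem_filter, Finset.mem_univ, true_and]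
      constructor
      · intro hy
        have := Fin.val_lt_last hy
        omega
      · intro hy heq
        rw [heq, Fin.val_last] at hy
        omega
    rw [hf]
    refine Finset.sum_congr rfl fun o ho => ?_
    rw [Finset.mem_filter] at ho
    rw [stepUp_eq_stepR o μ ho.2]
  simp_rw [e] at h
  refine h.trans (mul_le_mul_of_nonneg_right ?_ (Finset.sum_nonneg fun _ _ => Finset.sum_nonneg fun _ _ => sq_nonneg _))
  have hR0 : (0 : ℝ) ≤ R' := Nat.cast_nonneg _
  push_cast
  nlinarith

end Cube

/-! ## §2 The block chart of the scale-`t` anchors inside one unit block -/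

section Chart

variable (L : ℕ) [NeZero L] (M : Fin d → ℕ) [hM : ∀ μ, NeZero (M μ)] (k : ℕ) (i : ℕ)

/-- **THE BLOCK CHART**: for a scale-`n` anchor `Z` (a unit block) and `o ∈ [0, n/s_i)^d`, the scale-`s_i` anchor `Z + s_i·o` (leaf-07-g11's
`mulOff` offsets). [folklore] -/
def chartA (Z : Anc (fine (lev L k) M) (lev L k)) (o : Fin d → Fin (lev L k / sGW L k i)) : Anc (fine (lev L k) M) (sGW L k i) :=
  ⟨site (fine (lev L k) M) (lev L k) Z.1 (mulOff (lev L k) (sGW L k i) (sGW_dvd_lev L k i) o),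
    anchor_site_mulOff (fine (lev L k) M) (lev L k) (sGW L k i) (dvd_fine (lev L k) M) (sGW_dvd_lev L k i) Z o⟩

/-- the underlying site of the chart. [folklore] -/
theorem chartA_val (Z : Anc (fine (lev L k) M) (lev L k)) (o : Fin d → Fin (lev L k / sGW L k i)) :
    (chartA L M k i Z o).1 = site (fine (lev L k) M) (lev L k) Z.1 (mulOff (lev L k) (sGW L k i) (sGW_dvd_lev L k i) o) := rfl

/-- the chart stays in the unit block of `Z` (as a scale-`n` sub-block). [folklore] -/
theorem inSub_chartA (Z : Anc (fine (lev L k) M) (lev L k)) (o : Fin d → Fin (lev L k / sGW L k i)) :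
    InSub (fine (lev L k) M) (lev L k) Z.1 (chartA L M k i Z o).1 :=
  inSub_site (fine (lev L k) M) (lev L k) (dvd_fine (lev L k) M) Z.2 _

/-- … hence has the unit block of `Z`. [folklore] -/
theorem blockOf_chartA (Z : Anc (fine (lev L k) M) (lev L k)) (o : Fin d → Fin (lev L k / sGW L k i)) :
    blockOf (lev L k) M (chartA L M k i Z o).1 = blockOf (lev L k) M Z.1 :=
  blockOf_eq_of_inSub (lev L k) M (lev L k) dvd_rfl (inSub_chartA L M k i Z o)

/-- **ONE GRID STEP IS THE ANCHOR SHIFT**: `chartA Z (o + e_μ) = chartA Z o + s_i·e_μ` while `o_μ + 1 < n/s_i`. [folklore] -/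
theorem chartA_stepR (Z : Anc (fine (lev L k) M) (lev L k)) (o : Fin d → Fin (lev L k / sGW L k i)) (μ : Fin d)
    (h : (o μ : ℕ) + 1 < lev L k / sGW L k i) :
    chartA L M k i Z (stepR o μ) = shiftAnc (fine (lev L k) M) (sGW L k i) (sGW_dvd L M k i) μ (chartA L M k i Z o) := by
  apply Subtype.ext
  funext ν
  show site (fine (lev L k) M) (lev L k) Z.1 (mulOff (lev L k) (sGW L k i) (sGW_dvd_lev L k i) (stepR o μ)) ν
    = site (fine (lev L k) M) (lev L k) Z.1 (mulOff (lev L k) (sGW L k i) (sGW_dvd_lev L k i) o) ν + tstep (fine (lev L k) M) μ (sGW L k i) ν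
  simp only [site, mulOff_val, tstep]
  by_cases hν : ν = μ
  · subst hν
    rw [if_pos rfl, stepR_apply_self o ν h]
    push_cast
    ring
  · rw [if_neg hν, stepR_apply_ne o hν, add_zero]

/-- **THE CHART IS A BIJECTION `(unit block, grid point) ↔ scale-s_i anchor`**. [folklore] -/
theorem chartA_bijective :
    Function.Bijective (fun p : Anc (fine (lev L k) M) (lev L k) × (Fin d → Fin (lev L k / sGW L k i)) => chartA L M k i p.1 p.2) := by
  have hnN := dvd_fine (lev L k) M
  have ht0 : 0 < sGW L k i := s_pos (sGW L k i)
  constructor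
  · rintro ⟨Z, o⟩ ⟨Z', o'⟩ h
    have hZ : Z = Z' := by
      have hb := congrArg (fun w : Anc (fine (lev L k) M) (sGW L k i) => blockOf (lev L k) M w.1) h
      simp only [blockOf_chartA] at hb
      exact (blockOf_anchor_bijective (lev L k) M).1 hb
    subst hZ
    have ho := site_injective (fine (lev L k) M) (lev L k) hnN Z.2 (congrArg Subtype.val h)
    have ho' : o = o' := by
      funext ν
      have hν := congrArg (fun j : Fin d → Fin (lev L k) => (j ν : ℕ)) ho
      simp only [mulOff_val] at hν
      exact Fin.ext (Nat.eq_of_mul_eq_mul_left ht0 hν)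
    simp only [ho']
  · intro w
    set Z := anchorOf (fine (lev L k) M) (lev L k) w.1 with hZ
    obtain ⟨j, hj⟩ := eq_site_of_inSub (fine (lev L k) M) (lev L k) Z.2 (inSub_anchorOf (fine (lev L k) M) (lev L k) w.1)
    have hdvd : ∀ ν, sGW L k i ∣ (j ν : ℕ) := by
      intro ν
      have h1 : sGW L k i ∣ (w.1 ν).val := w.2 ν
      rw [hj, val_site (fine (lev L k) M) (lev L k) hnN Z.2 j ν] at h1
      have h2 : sGW L k i ∣ (Z.1 ν).val := dvd_trans (sGW_dvd_lev L k i) (Z.2 ν)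
      exact (Nat.dvd_add_right h2).mp h1
    refine ⟨⟨Z, fun ν => ⟨(j ν : ℕ) / sGW L k i, Nat.div_lt_div_of_lt_of_dvd (sGW_dvd_lev L k i) (j ν).isLt⟩⟩, ?_⟩
    apply Subtype.ext
    rw [chartA_val, hj]
    congr 1
    funext ν
    apply Fin.ext
    simp only [mulOff_val, Nat.mul_div_cancel' (hdvd ν)]

/-- re-indexing a sum over all scale-`s_i` anchors by (unit block, grid point). [folklore] -/
theorem sum_anchors_eq_sum_chart (G : Anc (fine (lev L k) M) (sGW L k i) → ℝ) :
    ∑ w, G w = ∑ Z : Anc (fine (lev L k) M) (lev L k), ∑ o : Fin d → Fin (lev L k / sGW L k i), G (chartA L M k i Z o) := by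
  rw [← Fintype.sum_prod_type']
  exact (Fintype.sum_bijective _ (chartA_bijective L M k i) (fun p => G (chartA L M k i p.1 p.2)) G fun _ => rfl).symm

/-- the same for complex-valued summands. [folklore] -/
theorem sum_anchors_eq_sum_chartC (G : Anc (fine (lev L k) M) (sGW L k i) → ℂ) :
    ∑ w, G w = ∑ Z : Anc (fine (lev L k) M) (lev L k), ∑ o : Fin d → Fin (lev L k / sGW L k i), G (chartA L M k i Z o) := by
  rw [← Fintype.sum_prod_type']
  exact (Fintype.sum_bijective _ (chartA_bijective L M k i) (fun p => G (chartA L M k i p.1 p.2)) G fun _ => rfl).symm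

/-- the sub-block of `chartA Z o` lies in the unit block of `Z′` iff `Z′ = Z`. [folklore] -/
theorem inSub_chartA_iff (Z Z' : Anc (fine (lev L k) M) (lev L k)) (o : Fin d → Fin (lev L k / sGW L k i)) :
    InSub (fine (lev L k) M) (lev L k) Z'.1 (chartA L M k i Z o).1 ↔ Z' = Z := by
  constructor
  · intro h
    have h1 := eq_anchorOf_of_inSub (fine (lev L k) M) (lev L k) (w := Z') h
    have h2 := eq_anchorOf_of_inSub (fine (lev L k) M) (lev L k) (w := Z) (inSub_chartA L M k i Z o)
    exact h1.trans h2.symm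
  · intro h
    rw [h]
    exact inSub_chartA L M k i Z o

/-! ## §3 Zero unit mean ⟹ the sub-block means over the grid of the block sum to zero -/

/-- `s^d·(Q′_s f)(w) = Σ_{y ∈ B_s(w)} f y`. [folklore] -/
theorem pow_mul_meanS (s : ℕ) [NeZero s] (f : TorK L M k → ℂ) (w : Anc (fine (lev L k) M) s) :
    ((s : ℂ) ^ d) * (meanS (fine (lev L k) M) s *ᵥ f) w = ∑ y, (if InSub (fine (lev L k) M) s w.1 y then f y else 0) := by
  have hs : ((s : ℂ) ^ d) ≠ 0 := pow_ne_zero _ (by exact_mod_cast NeZero.ne s)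
  simp only [Matrix.mulVec, dotProduct, meanS, ite_mul, zero_mul]
  rw [Finset.mul_sum]
  refine Finset.sum_congr rfl fun y _ => ?_
  split_ifs
  · rw [← mul_assoc, mul_inv_cancel₀ hs, one_mul]
  · rw [mul_zero]

/-- **ZERO UNIT MEAN ⟹ ZERO GRID SUM**: if the scale-`n` mean of `f` over the unit block `Z` vanishes, then
`Σ_{o ∈ [0,n/s_i)^d} (Q′_{s_i} f)(Z + s_i·o) = 0` (means of means). [cite: Balaban1984PropagatorsII, (2.7) p.225 (shape)] [folklore] -/
theorem sum_chart_meanS_eq_zero (f : TorK L M k → ℂ) (Z : Anc (fine (lev L k) M) (lev L k))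
    (h0 : (meanS (fine (lev L k) M) (lev L k) *ᵥ f) Z = 0) :
    ∑ o : Fin d → Fin (lev L k / sGW L k i), (meanS (fine (lev L k) M) (sGW L k i) *ᵥ f) (chartA L M k i Z o) = 0 := by
  have ht : ((sGW L k i : ℂ) ^ d) ≠ 0 := pow_ne_zero _ (by exact_mod_cast NeZero.ne (sGW L k i))
  -- the unit block sum vanishes
  have h1 : ∑ y, (if InSub (fine (lev L k) M) (lev L k) Z.1 y then f y else 0) = 0 := by
    rw [← pow_mul_meanS L M k (lev L k) f Z, h0, mul_zero]
  -- refine it into scale-`s_i` sub-blocks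
  rw [sum_inSub_refine (fine (lev L k) M) (lev L k) (sGW L k i) (sGW_dvd_lev L k i) Z.1 f] at h1
  simp_rw [← pow_mul_meanS L M k (sGW L k i) f] at h1
  rw [sum_anchors_eq_sum_chartC L M k i, Finset.sum_eq_single Z] at h1
  · simp_rw [if_pos (inSub_chartA L M k i Z _)] at h1
    rw [← Finset.mul_sum] at h1
    exact (mul_eq_zero.mp h1).resolve_left ht
  · intro Z' _ hZ'
    refine Finset.sum_eq_zero fun o _ => ?_
    rw [if_neg]
    rw [inSub_chartA_iff]
    exact fun h => hZ' h.symm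
  · exact fun h => absurd (Finset.mem_univ Z) h

end Chart

end Summit.QuantumFields.BalabanUV.T4Continuum.GradedWellBlockChart

end
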